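import Summits.RiemannHypothesis.RiemannHypothesis.Theorems.JensenPolynomialsSqrtLogRange
import Summits.RiemannHypothesis.RiemannHypothesis.Theorems.JensenPolynomialsSkeletonXi
import HarnessLib

/-!
# The J-P(P1) / J-P(P1′) leaves `TheoremAlpha`, `JensenCubicRangeTwo`, `ExplicitGORTTWPow10` are COROLLARIES
# of the proved J-P(P1″) leaf `JensenSqrtLogRangeTwenty` + the `d ≤ 10⁶` all-shift certificate (RH-FREE)

Planner sketch (planner-rh-idea-8-g0-0, 2026-08-27; NOT landed — handed to the rh-jensen custodian / a prover).
RH-FREE bookkeeping between typed rung leaves: for `d ≤ 10⁶` every shift is hyperbolic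
(`jensenPoly_xiTaylorCoeff_splits_allShifts_of_le_1e6'`); for `d > 10⁶` each of the three hypotheses
(`27 d³ ≤ 200 n`, `2 d³ ≤ n`, `10^{2d+5} ≤ n`) forces `n ≥ 20000` and `20·√d·log n ≤ n`, i.e. the cell of
`jensenSqrtLogRangeTwenty_holds`. Nothing here bears on the truth of RH.
-/

noncomputable section

set_option linter.dupNamespace false

namespace Summit.RiemannHypothesis.RiemannHypothesis.Theorems.JensenPolynomials

open Literature.NumberTheory.LFunctions

/-- Arithmetic: if `d³ ≤ 8 n` and `n ≥ 2·10⁶` (as naturals) then `20·√d·log n ≤ n` (reals). -/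
theorem sqrtLog_of_cube_le {d n : ℕ} (hd1 : 1 ≤ d) (hdn : d ^ 3 ≤ 8 * n) (hn : 2000000 ≤ n) :
    20 * Real.sqrt d * Real.log n ≤ n := by
  have hnR : (2000000 : ℝ) ≤ n := by exact_mod_cast hn
  have hn0 : (0 : ℝ) ≤ n := by linarith
  have hd1R : (1 : ℝ) ≤ d := by exact_mod_cast hd1
  have hdnR : (d : ℝ) ^ 3 ≤ 8 * n := by exact_mod_cast hdn
  -- √d ≤ d
  have hsqrt : Real.sqrt d ≤ (d : ℝ) := Real.sqrt_le_self_iff.mpr (Or.inr hd1R)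
  -- log n ≤ 3 n^{1/3}
  have hlog : Real.log n ≤ (n : ℝ) ^ ((1 : ℝ) / 3) / ((1 : ℝ) / 3) :=
    Real.log_le_rpow_div hn0 (by norm_num)
  have hlog' : Real.log n ≤ 3 * (n : ℝ) ^ ((1 : ℝ) / 3) := by
    have : (n : ℝ) ^ ((1 : ℝ) / 3) / ((1 : ℝ) / 3) = 3 * (n : ℝ) ^ ((1 : ℝ) / 3) := by ring
    linarith [this ▸ hlog]
  have hlog0 : 0 ≤ Real.log n := Real.log_nonneg (by linarith)
  have hcr0 : 0 ≤ (n : ℝ) ^ ((1 : ℝ) / 3) := Real.rpow_nonneg hn0 _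
  have hcr3 : ((n : ℝ) ^ ((1 : ℝ) / 3)) ^ 3 = n := by
    rw [← Real.rpow_natCast, ← Real.rpow_mul hn0]
    norm_num
  -- (log n)^3 ≤ 27 n
  have hlog3 : Real.log n ^ 3 ≤ 27 * n := by
    have h1 : Real.log n ^ 3 ≤ (3 * (n : ℝ) ^ ((1 : ℝ) / 3)) ^ 3 :=
      pow_le_pow_left₀ hlog0 hlog' 3
    have h2 : (3 * (n : ℝ) ^ ((1 : ℝ) / 3)) ^ 3 = 27 * n := by
      rw [mul_pow, hcr3]; norm_num
    linarith [h1, h2]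
  -- (20 d log n)^3 ≤ 8000 · 8n · 27n ≤ n^3
  have hmain3 : (20 * (d : ℝ) * Real.log n) ^ 3 ≤ (n : ℝ) ^ 3 := by
    have hd0 : (0 : ℝ) ≤ d := by linarith
    have e1 : (20 * (d : ℝ) * Real.log n) ^ 3 = 8000 * (d : ℝ) ^ 3 * Real.log n ^ 3 := by ring
    rw [e1]
    have e2 : 8000 * (d : ℝ) ^ 3 * Real.log n ^ 3 ≤ 8000 * (8 * (n : ℝ)) * (27 * (n : ℝ)) := by
      have hl3 : 0 ≤ Real.log n ^ 3 := pow_nonneg hlog0 3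
      calc 8000 * (d : ℝ) ^ 3 * Real.log n ^ 3 ≤ 8000 * (8 * (n : ℝ)) * Real.log n ^ 3 := by
            apply mul_le_mul_of_nonneg_right _ hl3
            linarith
        _ ≤ 8000 * (8 * (n : ℝ)) * (27 * (n : ℝ)) := by
            apply mul_le_mul_of_nonneg_left hlog3
            positivity
    have e3 : 8000 * (8 * (n : ℝ)) * (27 * n) ≤ (n : ℝ) ^ 3 := by
      have : 8000 * (8 * (n : ℝ)) * (27 * n) = 1728000 * n ^ 2 := by ring
      rw [this]
      nlinarith [hnR, hn0, sq_nonneg (n : ℝ)]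
    linarith
  have h20 : 0 ≤ 20 * (d : ℝ) * Real.log n := by positivity
  have hmain : 20 * (d : ℝ) * Real.log n ≤ n :=
    le_of_pow_le_pow_left₀ (by norm_num) hn0 hmain3
  calc 20 * Real.sqrt d * Real.log n ≤ 20 * (d : ℝ) * Real.log n := by
        apply mul_le_mul_of_nonneg_right _ hlog0
        linarith
    _ ≤ n := hmain

/-- **J-P(P1) leaf as a corollary (RH-FREE):** THEOREM α's range form `TheoremAlpha`
(`∀ d ≥ 3, n ≥ 10⁴, 27 d³ ≤ 200 n ⇒ J^{d,n}_γ hyperbolic`) follows from the proved √d·log d leaf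
`jensenSqrtLogRangeTwenty_holds` (`d > 10⁶`) and the `d ≤ 10⁶` all-shift certificate. -/
theorem theoremAlpha_of_sqrtLogRange : TheoremAlpha := by
  intro d n hd hn hdn
  by_cases hd6 : d ≤ 1000000
  · exact jensenPoly_xiTaylorCoeff_splits_allShifts_of_le_1e6' hd6 n
  · push Not at hd6
    have hd3 : 1000000 ^ 3 < d ^ 3 := Nat.pow_lt_pow_left hd6 (by norm_num)
    have hn' : 2000000 ≤ n := by
      have : (1000000 : ℕ) ^ 3 = 1000000000000000000 := by norm_num
      omega
    have hcube : d ^ 3 ≤ 8 * n := by omega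
    exact KimLee.jensenSqrtLogRangeTwenty_holds d n (by omega)
      (sqrtLog_of_cube_le (by omega) hcube hn')

/-- **J-P(P1′) leaf as a corollary (RH-FREE):** `JensenCubicRangeTwo` (`n ≥ 2d³`, all `d ≥ 3`). -/
theorem jensenCubicRangeTwo_of_sqrtLogRange : JensenCubicRangeTwo :=
  jensenCubicRangeTwo_of_theoremAlpha theoremAlpha_of_sqrtLogRange

-- typer-applied repair «jp-a» (rh-split typer-4 g0, gate dry-run `dedup.landed`): the third corollary
-- `explicitGORTTWPow10_of_sqrtLogRange : ExplicitGORTTWPow10` of the planner's file 6b6aaaa573421b82 is DELETED here —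
-- that leaf is already the tree theorem `JensenPolynomials.explicitGORTTWPow10_holds`
-- (Theorems/JensenPolynomialsExplicitGORTTWLeaf.lean); cite it by name. No other byte changed.

end Summit.RiemannHypothesis.RiemannHypothesis.Theorems.JensenPolynomials

end
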